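import Summits.QuantumAdvantage.QuantumAdvantage.Theorems.CubicForrelationNearExactIsExactBentMinWeightTools
import Summits.QuantumAdvantage.QuantumAdvantage.Theorems.CubicForrelationNearExactIsExactBentLadderFourteen

/-!
# Crux `CubicForrelation.NearExactIsExact` (stmt-QuantumAdvantage-14043) — the bent-side LADDER on 4-flats inside the prefix flat, EVERY
  `n = 4b + 14` (Kasami–Tokura line `|S| = 1.5·d`, `Φ = 1 − 3/2^{b+5}`; `b + 3` prefix factors)

Certificate seat `b2b-cforr-cert` (gen 45).  HONEST FRAMING: one kernel-checked LEMMA (standard axioms), uniform in `n`: the generalisation of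
`kb_ladder_four` (gen 44, `n = 14`, three prefix factors) / `kb_ladder_four_eighteen` / `kb_ladder_four_twentytwo` to every `n ≡ 2 (mod 4)`,
`n ≥ 14`, with the number `s = b + 3` of prefix factors growing with `n`.  It is step (T1) of the uniform version of THEOREM BENT's `1.5·d`
line (DISPROOF.md §18.2/18.6(a)); the remaining steps (fibre structure `kb_fibre_structure` and constant shifts `kb_shift_on_S` are already
uniform; the final plateau/`L¹` contradiction of …BentFourteenTwentyNineThirtySeconds is not yet) are left to a successor.  NOT summit progress.

`kb_ladder_four_all`: `f, g` cubic on `n = 2(2b+7)` bits, `W_g = 2^{2b+7}(−1)^d`, `f ⊕ d = Q ∧ P₀⋯P_{b+2}` pointwise with `Q = A₀A₁ ⊕ A₂A₃` and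
`P_j` flipped by `u_j` (each `u_k` fixing the other `P`'s); then for every base point `q` with `P(q) = 1` and every four directions `a` fixing
every `P_j`: `4 ∣ Σ_{ε ∈ 𝔽₂⁴} [Q(q ⊕ a_ε)]·(−1)^{f(q ⊕ a_ε)}`.  Proof: the two-sided congruence `Σ τ ≡ 0 (mod 32)` on the parametrised
`(b+7)`-flat `q ⊕ ⟨u₀,…,u_{b+2},a₀,…,a₃⟩` (`fs_flat_sum_dvd`: `(2b+5)+5 ≤ (b+7)+⌈(3b+7)/3⌉`, equality; `sl_sum_sZ_flat`: `2^{⌈(b+7)/3⌉+…} ≥ 8`),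
written as a LIST sum (`kbm_sum_flat_list`), then ALL `b + 3` prefix directions peeled at once by the predicate form `kbl_peel_all` of the
list-peeling lemma (the points translated by `u_k` leave `{P_k = 1}`, where `τ = 0`).

References: J. Ax (1964) / R. J. McEliece (1972); T. Kasami, N. Tokura (1970) Thm 1; DISPROOF.md §18.  Axioms: the standard three.
-/

set_option linter.dupNamespace false -- D-0017: single-problem summit ⇒ `QuantumAdvantage.QuantumAdvantage` by design

noncomputable section

namespace Summit.QuantumAdvantage.QuantumAdvantage.Theorems.CubicForrelation.NearExactIsExact

open Finset
open Literature.Computability.QuantumComplexity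
open Literature.Computability.QuantumComplexity.BuzetChailloux (bxor zeroVec bxor_self bxor_zeroVec zeroVec_bxor bxor_comm
  bxor_bxor_cancel_left)
open Literature.Computability.QuantumComplexity.DerivativeWalsh (W)

variable {n : ℕ}

/-! ### Peeling in predicate form -/

/-- **Invariant predicates propagate along `P(ts, q)`.**  If `Pr` is invariant under translation by a set `U` containing the directions and
`Pr q` holds, then `Pr` holds at every point of `P(ts, q) = ts.foldr (fun t L => L ++ L.map (· ⊕ t)) [q]`. [folklore] -/
theorem kbl_pts_prop : ∀ (ts : List (Fin n → Bool)) (U : Finset (Fin n → Bool)) (Pr : (Fin n → Bool) → Prop),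
    (∀ x, Pr x → ∀ t ∈ U, Pr (bxor x t)) → (∀ t ∈ ts, t ∈ U) → ∀ q, Pr q →
    ∀ x ∈ ts.foldr (fun t L => L ++ L.map (fun x => bxor x t)) [q], Pr x := by
  intro ts
  induction ts with
  | nil =>
    intro U Pr _ _ q hq x hx
    rw [List.foldr_nil, List.mem_singleton] at hx
    rw [hx]; exact hq
  | cons t ts ih =>
    intro U Pr hinv hts q hq x hx
    rw [List.foldr_cons, List.mem_append, List.mem_map] at hx
    have hts' : ∀ t' ∈ ts, t' ∈ U := fun t' ht' => hts t' (List.mem_cons_of_mem _ ht')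
    rcases hx with hx | ⟨y, hy, rfl⟩
    · exact ih U Pr hinv hts' q hq x hx
    · exact hinv y (ih U Pr hinv hts' q hq y hy) t (hts t List.mem_cons_self)

/-- **Peeling every transversal direction, predicate form.**  Suppose that for each index `i` of `ts` there are a `⊕`-closed `Uᵢ ∋ 0` and a
predicate `Prᵢ`, invariant under `Uᵢ`, true at `q`, destroyed by translation by `ts[i]`, outside of which `τ` vanishes, with the later
directions and `rest` inside `Uᵢ`.  Then `(P(ts ++ rest, q).map τ).sum = (P(rest, q).map τ).sum`. [this work] -/
theorem kbl_peel_all (q : Fin n → Bool) (τ : (Fin n → Bool) → ℤ) (rest : List (Fin n → Bool)) :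
    ∀ (ts : List (Fin n → Bool)),
      (∀ i (hi : i < ts.length), ∃ (U : Finset (Fin n → Bool)) (Pr : (Fin n → Bool) → Prop),
        (∀ x, Pr x → ∀ t ∈ U, Pr (bxor x t)) ∧ Pr q ∧ (∀ x, Pr x → ¬ Pr (bxor x ts[i])) ∧ (∀ x, ¬ Pr x → τ x = 0) ∧
        (∀ i' (hi' : i' < ts.length), i < i' → ts[i'] ∈ U) ∧ (∀ r ∈ rest, r ∈ U)) →
      (((ts ++ rest).foldr (fun t L => L ++ L.map (fun x => bxor x t)) [q]).map τ).sum =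
        ((rest.foldr (fun t L => L ++ L.map (fun x => bxor x t)) [q]).map τ).sum := by
  intro ts
  induction ts with
  | nil => intro _; rfl
  | cons t ts ih =>
    intro hchain
    have hchain' : ∀ i (hi : i < ts.length), ∃ (U : Finset (Fin n → Bool)) (Pr : (Fin n → Bool) → Prop),
        (∀ x, Pr x → ∀ t ∈ U, Pr (bxor x t)) ∧ Pr q ∧ (∀ x, Pr x → ¬ Pr (bxor x ts[i])) ∧ (∀ x, ¬ Pr x → τ x = 0) ∧
        (∀ i' (hi' : i' < ts.length), i < i' → ts[i'] ∈ U) ∧ (∀ r ∈ rest, r ∈ U) := by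
      intro i hi
      obtain ⟨U, Pr, hinv, hPrq, hkill, hτ, hlater, hrest⟩ := hchain (i + 1) (by simp; omega)
      refine ⟨U, Pr, hinv, hPrq, by simpa using hkill, hτ, fun i' hi' hlt => ?_, hrest⟩
      have := hlater (i' + 1) (by simp; omega) (by omega)
      simpa using this
    obtain ⟨U, Pr, hinv, hPrq, hkill, hτ, hlater, hrest⟩ := hchain 0 (by simp)
    have hkill' : ∀ x, Pr x → ¬ Pr (bxor x t) := by simpa using hkill
    have hmem : ∀ t' ∈ ts ++ rest, t' ∈ U := by
      intro t' ht'
      rw [List.mem_append] at ht'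
      rcases ht' with h | h
      · obtain ⟨i, hi, rfl⟩ := List.getElem_of_mem h
        have := hlater (i + 1) (by simp; omega) (by omega)
        simpa using this
      · exact hrest t' h
    rw [List.cons_append, List.foldr_cons, List.map_append, List.sum_append, ih hchain', List.map_map]
    have hz : ((List.foldr (fun t L => L ++ L.map (fun x => bxor x t)) [q] (ts ++ rest)).map (τ ∘ fun x => bxor x t)).sum = 0 := by
      refine List.sum_eq_zero fun z hz => ?_
      rw [List.mem_map] at hz
      obtain ⟨y, hy, rfl⟩ := hz
      exact hτ _ (hkill' y (kbl_pts_prop (ts ++ rest) U Pr hinv hmem q hPrq y hy))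
    rw [hz, add_zero]

/-! ### The ladder, every `n = 4b + 14` -/

/-- **The ladder on 4-flats inside the prefix flat, every `n = 4b + 14` (line `|S| = 1.5·d`).**  See the module header.
[this work; cite: KasamiTokura1970, Thm 1] -/
theorem kb_ladder_four_all (b : ℕ) (f g d : (Fin ((2 * b + 7) + (2 * b + 7)) → Bool) → Bool) (hf : IsDegLeFun 3 f) (hg : IsDegLeFun 3 g)
    (hd : ∀ x, W (fun y => signOf (g y)) x = (2 : ℝ) ^ (2 * b + 7) * signOf (d x))
    (A : Fin 4 → (Fin ((2 * b + 7) + (2 * b + 7)) → Bool) → Bool) (P : Fin (b + 3) → (Fin ((2 * b + 7) + (2 * b + 7)) → Bool) → Bool)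
    (u : Fin (b + 3) → Fin ((2 * b + 7) + (2 * b + 7)) → Bool)
    (hPu : ∀ j x, P j (bxor x (u j)) = !P j x) (hPu' : ∀ j k x, j ≠ k → P j (bxor x (u k)) = P j x)
    (hnf : ∀ x, (f x ^^ d x) = (((A 0 x && A 1 x) ^^ (A 2 x && A 3 x)) && decide (∀ j, P j x = true)))
    (q : Fin ((2 * b + 7) + (2 * b + 7)) → Bool) (hq : ∀ j, P j q = true)
    (a : Fin 4 → Fin ((2 * b + 7) + (2 * b + 7)) → Bool) (ha : ∀ i j x, P j (bxor x (a i)) = P j x) :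
    (4 : ℤ) ∣ ∑ ε : Fin 4 → Bool,
      (if ((A 0 (fun l => q l ^^ decide (Odd #(univ.filter fun i => ε i && a i l))) &&
            A 1 (fun l => q l ^^ decide (Odd #(univ.filter fun i => ε i && a i l)))) ^^
           (A 2 (fun l => q l ^^ decide (Odd #(univ.filter fun i => ε i && a i l))) &&
            A 3 (fun l => q l ^^ decide (Odd #(univ.filter fun i => ε i && a i l))))) = true
        then sZ (f (fun l => q l ^^ decide (Odd #(univ.filter fun i => ε i && a i l)))) else 0) := by
  classical
  -- the residual `τ = W_g/2^{2b+5} − 4(−1)^f`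
  set ug : (Fin ((2 * b + 7) + (2 * b + 7)) → Bool) → ℤ := fun x => 4 * sZ (d x) with hug
  have hu : ∀ x, W (fun y => signOf (g y)) x = (2 : ℝ) ^ (2 * b + 5) * (ug x : ℝ) := by
    intro x; rw [hd x]; simp only [ug]; push_cast; rw [tp_sZ_cast]; ring
  set τ : (Fin ((2 * b + 7) + (2 * b + 7)) → Bool) → ℤ := fun x => ug x - 4 * sZ (f x) with hτ
  have hτ0 : ∀ z j, P j z = false → τ z = 0 := by
    intro z j hz
    have h := hnf z
    have hdec : decide (∀ j, P j z = true) = false := by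
      rw [decide_eq_false_iff_not]; intro hall; rw [hall j] at hz; exact Bool.noConfusion hz
    rw [hdec, Bool.and_false] at h
    have : f z = d z := by revert h; cases f z <;> cases d z <;> decide
    simp only [τ, ug]; rw [this]; ring
  have hτS : ∀ z, (∀ j, P j z = true) →
      τ z = (if ((A 0 z && A 1 z) ^^ (A 2 z && A 3 z)) = true then -8 * sZ (f z) else 0) := by
    intro z hz
    have h := hnf z
    rw [decide_eq_true hz, Bool.and_true] at h
    simp only [τ, ug]
    by_cases hQ : ((A 0 z && A 1 z) ^^ (A 2 z && A 3 z)) = true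
    · rw [if_pos hQ]
      rw [hQ] at h
      have : d z = !f z := by revert h; cases f z <;> cases d z <;> decide
      rw [this]; cases f z <;> simp [sZ]
    · rw [if_neg hQ]
      have hQ' : ((A 0 z && A 1 z) ^^ (A 2 z && A 3 z)) = false := by simpa using hQ
      rw [hQ'] at h
      have : f z = d z := by revert h; cases f z <;> cases d z <;> decide
      rw [this]; ring
  -- the `(b+7)`-flat congruence (any parametrisation)
  have h32 : ∀ {K : ℕ}, K = b + 7 → ∀ (c : Fin K → Fin ((2 * b + 7) + (2 * b + 7)) → Bool),
      (32 : ℤ) ∣ ∑ ε : Fin K → Bool, τ (fun j => q j ^^ decide (Odd #(univ.filter fun i => ε i && c i j))) := by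
    intro K hK c
    subst hK
    have h1 := fs_flat_sum_dvd (e := 5) g ug hg hu q c (by omega)
    obtain ⟨zf, hzf⟩ := sl_sum_sZ_flat f hf q c
    have hp : (2 : ℤ) ^ ((b + 7 + 2) / 3) = 8 * 2 ^ (b / 3) := by
      rw [show (b + 7 + 2) / 3 = b / 3 + 3 by omega, pow_add]; ring
    have h2 : ∑ ε : Fin (b + 7) → Bool, τ (fun j => q j ^^ decide (Odd #(univ.filter fun i => ε i && c i j))) =
        ∑ ε : Fin (b + 7) → Bool, ug (fun j => q j ^^ decide (Odd #(univ.filter fun i => ε i && c i j))) -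
        4 * ∑ ε : Fin (b + 7) → Bool, sZ (f (fun j => q j ^^ decide (Odd #(univ.filter fun i => ε i && c i j)))) := by
      simp only [τ]; rw [sum_sub_distrib, mul_sum]
    rw [h2, hzf, hp]
    norm_num at h1 ⊢
    exact dvd_sub h1 (Dvd.intro (2 ^ (b / 3) * zf) (by ring))
  -- the big flat `q ⊕ ⟨u₀, …, u_{b+2}, a₀, …, a₃⟩` as a list, all prefix directions peeled at once
  set l := List.ofFn u ++ List.ofFn a with hl
  have hlK : l.length = b + 7 := by simp [hl]
  have h7 := h32 hlK (fun i => l[(i : ℕ)])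
  rw [kbm_sum_flat_list l.length τ q (fun i => l[(i : ℕ)]), List.ofFn_getElem] at h7
  have hchain : ∀ i (hi : i < (List.ofFn u).length), ∃ (U : Finset (Fin ((2 * b + 7) + (2 * b + 7)) → Bool))
      (Pr : (Fin ((2 * b + 7) + (2 * b + 7)) → Bool) → Prop),
      (∀ x, Pr x → ∀ t ∈ U, Pr (bxor x t)) ∧ Pr q ∧ (∀ x, Pr x → ¬ Pr (bxor x (List.ofFn u)[i])) ∧ (∀ x, ¬ Pr x → τ x = 0) ∧
      (∀ i' (hi' : i' < (List.ofFn u).length), i < i' → (List.ofFn u)[i'] ∈ U) ∧ (∀ r ∈ List.ofFn a, r ∈ U) := by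
    intro i hi
    have hi' : i < b + 3 := by rw [List.length_ofFn] at hi; exact hi
    refine ⟨univ.filter fun t => ∀ x, P ⟨i, hi'⟩ (bxor x t) = P ⟨i, hi'⟩ x, fun x => P ⟨i, hi'⟩ x = true, ?_, hq _, ?_, ?_, ?_, ?_⟩
    · intro x hx t ht
      rw [(mem_filter.1 ht).2 x]; exact hx
    · intro x hx
      beta_reduce
      rw [List.getElem_ofFn, hPu, hx]; decide
    · intro x hx
      exact hτ0 x ⟨i, hi'⟩ (by simpa using hx)
    · intro i' hi'' hlt
      have hi''' : i' < b + 3 := by rw [List.length_ofFn] at hi''; exact hi''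
      rw [List.getElem_ofFn]
      exact mem_filter.2 ⟨mem_univ _, fun x => hPu' ⟨i, hi'⟩ ⟨i', hi'''⟩ x (fun h => by simp at h; omega)⟩
    · intro r hr
      rw [List.mem_ofFn] at hr
      obtain ⟨i₀, rfl⟩ := hr
      exact mem_filter.2 ⟨mem_univ _, fun x => ha i₀ ⟨i, hi'⟩ x⟩
  rw [kbl_peel_all q τ (List.ofFn a) (List.ofFn u) hchain, ← kbm_sum_flat_list 4 τ q a] at h7
  -- on the 4-flat every point lies in `U`
  have hU : ∀ ε : Fin 4 → Bool, ∀ j, P j (fun l => q l ^^ decide (Odd #(univ.filter fun i => ε i && a i l))) = true := by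
    intro ε j
    set V₀ := univ.filter (fun t : Fin ((2 * b + 7) + (2 * b + 7)) → Bool => ∀ x, P j (bxor x t) = P j x) with hV₀
    have h0 : zeroVec ∈ V₀ := mem_filter.2 ⟨mem_univ _, fun x => by rw [bxor_zeroVec]⟩
    exact fo_mem_flatPt V₀ h0 (fun x => P j x = true) (fun x hx t ht => by rw [(mem_filter.1 ht).2 x]; exact hx)
      (hq j) a (fun i => mem_filter.2 ⟨mem_univ _, ha i j⟩) ε
  rw [sum_congr rfl fun ε _ => hτS _ (hU ε)] at h7
  have e : ∑ ε : Fin 4 → Bool,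
      (if ((A 0 (fun l => q l ^^ decide (Odd #(univ.filter fun i => ε i && a i l))) &&
            A 1 (fun l => q l ^^ decide (Odd #(univ.filter fun i => ε i && a i l)))) ^^
           (A 2 (fun l => q l ^^ decide (Odd #(univ.filter fun i => ε i && a i l))) &&
            A 3 (fun l => q l ^^ decide (Odd #(univ.filter fun i => ε i && a i l))))) = true
        then -8 * sZ (f (fun l => q l ^^ decide (Odd #(univ.filter fun i => ε i && a i l)))) else 0) =
      -8 * ∑ ε : Fin 4 → Bool,
      (if ((A 0 (fun l => q l ^^ decide (Odd #(univ.filter fun i => ε i && a i l))) &&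
            A 1 (fun l => q l ^^ decide (Odd #(univ.filter fun i => ε i && a i l)))) ^^
           (A 2 (fun l => q l ^^ decide (Odd #(univ.filter fun i => ε i && a i l))) &&
            A 3 (fun l => q l ^^ decide (Odd #(univ.filter fun i => ε i && a i l))))) = true
        then sZ (f (fun l => q l ^^ decide (Odd #(univ.filter fun i => ε i && a i l)))) else 0) := by
    rw [mul_sum]
    refine sum_congr rfl fun ε _ => ?_
    split_ifs <;> ring
  rw [e, show (32 : ℤ) = -8 * -4 by norm_num] at h7
  have h4 := (mul_dvd_mul_iff_left (by norm_num : (-8 : ℤ) ≠ 0)).1 h7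
  rwa [neg_dvd] at h4

end Summit.QuantumAdvantage.QuantumAdvantage.Theorems.CubicForrelation.NearExactIsExact

end
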